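import Literature.NumberTheory.Automorphic.IwahoriGL
import Literature.NumberTheory.Automorphic.SmoothRepresentation
import Literature.NumberTheory.Automorphic.GLnCongruenceSubgroups
import HarnessLib

/-!
# The Iwahori multiplicity criterion for Gelfand–Kirillov dimension `≤ f`
# (Breuil–Herzig–Hu–Morra–Schraen, Thm. 1.6)

Topic `NumberTheory/Automorphic`.  ONE named fact, vendored for the Langlands route
`route-Langlands-EisensteinGelfandKirillov` (door `EisensteinGKBound`): Theorem 1.6 of the
introduction of Breuil–Herzig–Hu–Morra–Schraen, *Gelfand–Kirillov dimension and mod `p`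
cohomology for `GL₂`* (Invent. Math. 234 (2023); it restates Cor. 5.3.5 of the body), a purely
local and purely representation-theoretic criterion.  Let `L` be the unramified extension of
`ℚ_p` of degree `f`, `K = GL₂(𝒪_L) ⊇ I ⊇ I₁` the Iwahori and pro-`p` Iwahori subgroups, `Z₁` the
centre of `I₁`, `𝔽` a finite field of characteristic `p`, `𝔪 = 𝔪_{I₁/Z₁}` the maximal ideal of the
Iwasawa algebra `𝔽⟦I₁/Z₁⟧`, and for a smooth representation `π` on which `Z₁` acts trivially
`π[𝔪ⁿ]` the subspace killed by `𝔪ⁿ` (so `π[𝔪] = π^{I₁}`).  The theorem, verbatim: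

> **Theorem 1.6 (Corollary 5.3.5).** Let `π` be an admissible smooth representation of
> `GL₂(F_v)` over `𝔽` with a central character and assume `[π[𝔪³_{I₁/Z₁}] : χ] = [π[𝔪_{I₁/Z₁}] : χ]`
> for all `χ : I → 𝔽^×` such that `[π[𝔪_{I₁/Z₁}] : χ] ≠ 0`.  Then `dim_{GL₂(F_v)}(π) ≤ f`.

Here `[V : χ]` is "the multiplicity of `χ` in the semisimplification of `V`" (§1.4) and
`dim_{GL₂(F_v)}(π)` is the Gelfand–Kirillov dimension of §5.1, for which §1.2 prints the
equivalent description: "it is the unique integer such that there exist `a ≤ b` in `ℝ_{>0}`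
satisfying `a ≤ dim_𝔽(π^{K_n}) / p^{n dim(π)} ≤ b` for all `n ≥ 1`", `K_n = 1 + pⁿ M₂(𝒪_{F_v})`.

## Rendering (all deviations are WEAKENINGS of the print, or equivalent reformulations)

* *The field.*  `F_v = L` is a non-archimedean local field (`IsNonarchimedeanLocalField`, with the
  tree's `ValuativeRel` vocabulary `𝒪[F]`, `𝓂[F]`, `𝓀[F]`) in which `p` is a uniformiser,
  `𝓂[F] = (p)`, with residue field of cardinality `p ^ f`: this says exactly that `F` has
  characteristic `0` (else `(p) = 0 ≠ 𝓂`), residue characteristic `p`, ramification index `1`,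
  i.e. `F` is the unramified extension of `ℚ_p` of degree `f = [F : ℚ_p]`.
* *The prime.*  The introduction's standing assumption is `p > 2` (§1.2), but Cor. 5.3.5 and its
  input Thm. 5.3.4 are proved in §5.3 under "We assume that `p > 3`" (needed for Lazard's
  saturated `p`-valuation on `I₁/Z₁`), and §6 of the final arXiv version (v7 = the published
  text) also opens with "we always assume that `p > 3`".  We therefore vendor the hypothesis
  `3 < p` (weaker than the introduction's literal reading; the requesting route asked for `p > 2`
  — for `p = 3` the printed proof does not apply as written).
* *`π[𝔪ⁿ]`.*  `augIdealTorsion π I₁ n`: the vectors killed by all `n`-fold products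
  `(h₁ - 1)⋯(hₙ - 1)`, `hᵢ ∈ I₁` (defined recursively: `v ∈ π[𝔪ⁿ⁺¹] ↔ ∀ h ∈ I₁, h v - v ∈ π[𝔪ⁿ]`,
  `π[𝔪⁰] = 0`; `π[𝔪¹] = π^{I₁}`, `augIdealTorsion_one`).  For a smooth vector the action of
  `𝔽⟦I₁⟧` factors through a finite group ring `𝔽[I₁/U]`, in which the image of `𝔪ⁿ` is spanned
  by such products, so this IS the `𝔪ⁿ_{I₁}`-torsion; and `𝔪_{I₁}`- and `𝔪_{I₁/Z₁}`-torsion agree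
  because `Z₁` acts trivially on `π` (the paper, proof of Thm. 6.4.1: "As `π` has a central
  character, the group `Z₁` acts trivially on `π`"; cf. the remark after (6.1): "the actions of
  `𝔪ⁿ_{I₁}` and `𝔪ⁿ_{I₁/Z₁}` coincide").
* *The multiplicity condition*, rendered without Jordan–Hölder theory.  `π[𝔪] ⊆ π[𝔪²] ⊆ π[𝔪³]`
  are `I`-stable (`I` normalises `I₁`, `apply_mem_augIdealTorsion`), `I₁` acts trivially on each
  layer `π[𝔪ⁱ⁺¹]/π[𝔪ⁱ]`, and `I/I₁ ≅ (k^×)²` is a finite group of order prime to `p`, so each layer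
  is a semisimple `I`-representation (Maschke) in which the multiplicity of the character `χ` is
  `dim_𝔽 Hom_I(χ, –)`; by additivity of `[– : χ]`,
  `[π[𝔪³] : χ] = [π[𝔪] : χ] + dim Hom_I(χ, π[𝔪²]/π[𝔪]) + dim Hom_I(χ, π[𝔪³]/π[𝔪²])` (all finite,
  `π` being admissible).  Hence `[π[𝔪³] : χ] = [π[𝔪] : χ]` iff `χ` has no eigenvector in either
  layer, i.e. `¬ OccursMod π I χ π[𝔪²] π[𝔪] ∧ ¬ OccursMod π I χ π[𝔪³] π[𝔪²]`, and
  `[π[𝔪] : χ] ≠ 0` iff `χ` has an eigenvector in `π[𝔪] = π^{I₁}` (`OccursMod … π[𝔪] ⊥`).  The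
  characters `χ : I → 𝔽^×` of the print are the smooth ones; a character with an eigenvector in
  `π^{I₁}` is automatically trivial on the open subgroup `I₁`, so we quantify over all group
  homomorphisms `I →* 𝔽ˣ` (same condition).
* *The conclusion* `dim_{GL₂(F_v)}(π) ≤ f` is rendered through the printed equivalent description
  of the dimension by the growth of `dim_𝔽 π^{K_n}`: there is `C` with
  `dim_𝔽 π^{K_n} ≤ C · p^{n f}` for all `n ≥ 1` (`K_n = congruenceGL 2 |pⁿ|`, the tree's principal
  congruence subgroups; `Module.finrank`, the spaces `π^{K_n}` being finite-dimensional by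
  admissibility).  This is implied by, and — granted the printed description — equivalent to,
  `dim(π) ≤ f`; it is the form the requesting route asked for.
* Not vendored here: Thm. 1.4 (= Thm. 6.4.1, the criterion in terms of `π^{K₁} ≅ D₀(ρ̄ᵛ)^{⊕r}` and
  `[π[𝔪²_{K₁}] : σ] = [π[𝔪_{K₁}] : σ]` for Serre weights `σ ∈ W(ρ̄ᵛ)`), which needs Serre weights,
  `GL₂(k)`-injective envelopes and the Breuil–Paškūnas representation `D₀(ρ̄)`, none of which the
  tree has; Thm. 1.6 is the purely Iwahori-theoretic half that the route's door uses.

## References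

* C. Breuil, F. Herzig, Y. Hu, S. Morra, B. Schraen, *Gelfand–Kirillov dimension and mod `p`
  cohomology for `GL₂`*, Invent. Math. 234 (2023) 1–128, §1.2 (definition of `dim_{GL₂(F_v)}(π)`,
  `K_n = 1 + pⁿM₂(𝒪_{F_v})`, the growth description, "we assume `p > 2`"), §1.3 Thm. 1.6
  (= Cor. 5.3.5), §1.4 (notation `[V : σ]`, `𝔪_G`), §5.1 (Gelfand–Kirillov dimension), §5.3
  ("`L` unramified of degree `f`", "We assume that `p > 3`", Thm. 5.3.4, Cor. 5.3.5), §6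
  (Thm. 6.4.1 = Thm. 1.4 and its proof); arXiv:2009.03127 (v7 = published text).
  [cite: BreuilEtAl2023, Thm. 1.6]
-/

open scoped ValuativeRel

namespace Literature.NumberTheory.Automorphic

/-! ### `𝔪ⁿ`-torsion of a representation with respect to a subgroup -/

section Torsion

variable {k G V : Type*} [CommRing k] [Group G] [AddCommGroup V] [Module k V]

/-- **`𝔪ⁿ_H`-torsion** `π[𝔪ⁿ_H]` of a representation `ρ` of `G` with respect to a subgroup
`H ≤ G`: the vectors killed by every `n`-fold product `(ρ h₁ - 1) ⋯ (ρ hₙ - 1)` with `hᵢ ∈ H`,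
defined recursively by `π[𝔪⁰] = 0` and `v ∈ π[𝔪ⁿ⁺¹] ↔ ∀ h ∈ H, ρ h v - v ∈ π[𝔪ⁿ]`.  For a smooth
representation of a profinite `H` over a field of characteristic `p` this is the subspace
annihilated by the `n`-th power of the augmentation ideal `𝔪_H` of the completed group ring
`k⟦H⟧` (Breuil–Herzig–Hu–Morra–Schraen §1.4, §6.1: `π[𝔪ⁿ]`; `π[𝔪_{I₁}] = π^{I₁}`).
[cite: BreuilEtAl2023, §1.3–1.4] -/
def augIdealTorsion (ρ : Representation k G V) (H : Subgroup G) : ℕ → Submodule k V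
  | 0 => ⊥
  | n + 1 => ⨅ h : H, (augIdealTorsion ρ H n).comap (ρ (h : G) - LinearMap.id)

/-- `π[𝔪⁰] = 0`. [folklore] -/
@[simp] theorem augIdealTorsion_zero (ρ : Representation k G V) (H : Subgroup G) :
    augIdealTorsion ρ H 0 = ⊥ := rfl

/-- The recursion: `v ∈ π[𝔪ⁿ⁺¹] ↔ ∀ h ∈ H, ρ h v - v ∈ π[𝔪ⁿ]`. [folklore] -/
theorem mem_augIdealTorsion_succ {ρ : Representation k G V} {H : Subgroup G} {n : ℕ} {v : V} :
    v ∈ augIdealTorsion ρ H (n + 1) ↔ ∀ h : H, ρ (h : G) v - v ∈ augIdealTorsion ρ H n := by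
  simp only [augIdealTorsion, Submodule.mem_iInf, Submodule.mem_comap, LinearMap.sub_apply,
    LinearMap.id_apply]

/-- `π[𝔪¹_H] = π^H`, the `H`-fixed vectors (BHHMS §1.3: "`π[𝔪_{I₁/Z₁}] = π^{I₁}`"). [folklore] -/
theorem augIdealTorsion_one (ρ : Representation k G V) (H : Subgroup G) :
    augIdealTorsion ρ H 1 = ρ.fixedPoints H := by
  ext v
  rw [mem_augIdealTorsion_succ, Representation.mem_fixedPoints]
  simp only [augIdealTorsion_zero, Submodule.mem_bot, sub_eq_zero, Subtype.forall]

/-- `π[𝔪²_H]` unfolded: `v` is killed by all products `(ρ h₂ - 1)(ρ h₁ - 1)`. [folklore] -/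
theorem mem_augIdealTorsion_two {ρ : Representation k G V} {H : Subgroup G} {v : V} :
    v ∈ augIdealTorsion ρ H 2 ↔
      ∀ h₁ h₂ : H, ρ (h₂ : G) (ρ (h₁ : G) v - v) = ρ (h₁ : G) v - v := by
  simp only [mem_augIdealTorsion_succ, augIdealTorsion_zero, Submodule.mem_bot, sub_eq_zero]

/-- `π[𝔪ⁿ] ⊆ π[𝔪ⁿ⁺¹]`. [folklore] -/
theorem augIdealTorsion_le_succ (ρ : Representation k G V) (H : Subgroup G) :
    ∀ n : ℕ, augIdealTorsion ρ H n ≤ augIdealTorsion ρ H (n + 1)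
  | 0 => bot_le
  | n + 1 => fun _ hv => mem_augIdealTorsion_succ.2 fun h =>
      augIdealTorsion_le_succ ρ H n (mem_augIdealTorsion_succ.1 hv h)

/-- The torsion filtration `π[𝔪⁰] ⊆ π[𝔪¹] ⊆ π[𝔪²] ⊆ ⋯` is increasing. [folklore] -/
theorem augIdealTorsion_mono (ρ : Representation k G V) (H : Subgroup G) :
    Monotone (augIdealTorsion ρ H) :=
  monotone_nat_of_le_succ (augIdealTorsion_le_succ ρ H)

/-- Each `π[𝔪ⁿ_H]` is stable under every `g ∈ G` normalising `H` (so `π[𝔪ⁿ_{I₁}]` is a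
representation of the Iwahori subgroup `I`, which normalises `I₁`). [folklore] -/
theorem apply_mem_augIdealTorsion {ρ : Representation k G V} {H : Subgroup G} {g : G}
    (hg : ∀ h : G, h ∈ H → g⁻¹ * h * g ∈ H) :
    ∀ {n : ℕ} {v : V}, v ∈ augIdealTorsion ρ H n → ρ g v ∈ augIdealTorsion ρ H n
  | 0, v, hv => by
      rw [augIdealTorsion_zero, Submodule.mem_bot] at hv ⊢
      rw [hv, map_zero]
  | n + 1, v, hv => by
      rw [mem_augIdealTorsion_succ] at hv ⊢
      intro h
      have key : ρ g (ρ (g⁻¹ * h * g) v - v) = ρ (h : G) (ρ g v) - ρ g v := by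
        simp only [map_sub, map_mul, Module.End.mul_apply, Representation.self_inv_apply]
      rw [← key]
      exact apply_mem_augIdealTorsion hg (hv ⟨_, hg h h.2⟩)

/-- **Occurrence of a character in a layer.**  For subspaces `W ⊆ W'` of a representation `ρ`
stable under a subgroup `I` and a character `χ : I →* kˣ`: `χ` has an eigenvector in `W'/W`,
i.e. there is `v ∈ W' \ W` with `ρ g v ≡ χ(g) v (mod W)` for all `g ∈ I`.  When `W'/W` is a
semisimple `I`-representation this says that the multiplicity `[W'/W : χ]` is non-zero; with
`W = ⊥` it says that `χ` occurs in `soc_I W'` (BHHMS §1.4: `[V : σ]`). [cite: BreuilEtAl2023, §1.4] -/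
def OccursMod (ρ : Representation k G V) (I : Subgroup G) (χ : I →* kˣ) (W' W : Submodule k V) :
    Prop :=
  ∃ v ∈ W', v ∉ W ∧ ∀ g : I, ρ (g : G) v - ((χ g : kˣ) : k) • v ∈ W

/-- Unfolding `OccursMod` against the zero subspace: a genuine non-zero `χ`-eigenvector in `W'`.
[folklore] -/
theorem occursMod_bot_iff {ρ : Representation k G V} {I : Subgroup G} {χ : I →* kˣ}
    {W' : Submodule k V} :
    OccursMod ρ I χ W' ⊥ ↔ ∃ v ∈ W', v ≠ 0 ∧ ∀ g : I, ρ (g : G) v = ((χ g : kˣ) : k) • v := by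
  simp only [OccursMod, Submodule.mem_bot, sub_eq_zero]

/-- `OccursMod` is vacuous when the two subspaces coincide. [folklore] -/
theorem not_occursMod_self {ρ : Representation k G V} {I : Subgroup G} {χ : I →* kˣ}
    {W : Submodule k V} : ¬ OccursMod ρ I χ W W := by
  rintro ⟨v, hv, hv', -⟩
  exact hv' hv

end Torsion

/-! ### The named fact -/

/-- **Breuil–Herzig–Hu–Morra–Schraen, Thm. 1.6 (= Cor. 5.3.5): the Iwahori multiplicity criterion
for Gelfand–Kirillov dimension `≤ f`.**  Verbatim (§1.3): "Let `π` be an admissible smooth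
representation of `GL₂(F_v)` over `𝔽` with a central character and assume
`[π[𝔪³_{I₁/Z₁}] : χ] = [π[𝔪_{I₁/Z₁}] : χ]` for all `χ : I → 𝔽^×` such that `[π[𝔪_{I₁/Z₁}] : χ] ≠ 0`.
Then `dim_{GL₂(F_v)}(π) ≤ f`."  Standing hypotheses (§1.2, §5, §5.3): `F_v` is the unramified
extension of `ℚ_p` of degree `f` (here: a non-archimedean local field with `𝓂 = (p)` and residue
field of cardinality `p ^ f`), `𝔽` is a finite field of characteristic `p`, `I ⊇ I₁` are the
upper Iwahori and pro-`p` Iwahori subgroups of `GL₂(𝒪_{F_v})` (`iwahoriGL`, `proPIwahoriGL`), and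
`p > 3` (the assumption in force in §5.3 where Cor. 5.3.5 is proved; the introduction says
`p > 2` — we keep the weaker printed-proof form).  The multiplicity hypothesis is rendered layer
by layer (`OccursMod`, `augIdealTorsion`; see the module docstring for the equivalence with the
printed Jordan–Hölder multiplicities via Maschke for `I/I₁`), and the conclusion through the
printed growth description of the dimension (§1.2): `dim_𝔽 π^{K_n} ≤ C · p^{n f}` for all `n ≥ 1`,
`K_n = 1 + pⁿ M₂(𝒪_{F_v})` (`congruenceGL 2 |pⁿ|`).
[cite: BreuilEtAl2023, Thm. 1.6] -/
def BreuilHerzigHuMorraSchraen2023_thm_1_6 : Prop :=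
  ∀ (p : ℕ) [Fact p.Prime], 3 < p →
  ∀ (F : Type) [Field F] [ValuativeRel F] [TopologicalSpace F] [IsNonarchimedeanLocalField F],
    𝓂[F] = Ideal.span {(p : 𝒪[F])} →
  ∀ (f : ℕ), Nat.card 𝓀[F] = p ^ f →
  ∀ (𝔽 : Type) [Field 𝔽] [Finite 𝔽] [CharP 𝔽 p]
    (V : Type) [AddCommGroup V] [Module 𝔽 V] (π : Representation 𝔽 (GL (Fin 2) F) V),
    π.IsAdmissible →
    (∃ ω : Subgroup.center (GL (Fin 2) F) →* 𝔽ˣ, π.HasCentralCharacter ω) →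
    (∀ χ : iwahoriGL 2 F →* 𝔽ˣ,
        OccursMod π (iwahoriGL 2 F) χ (augIdealTorsion π (proPIwahoriGL 2 F) 1) ⊥ →
          ¬ OccursMod π (iwahoriGL 2 F) χ (augIdealTorsion π (proPIwahoriGL 2 F) 2)
              (augIdealTorsion π (proPIwahoriGL 2 F) 1) ∧
          ¬ OccursMod π (iwahoriGL 2 F) χ (augIdealTorsion π (proPIwahoriGL 2 F) 3)
              (augIdealTorsion π (proPIwahoriGL 2 F) 2)) →
    ∃ C : ℝ, ∀ n : ℕ, 1 ≤ n →
      (Module.finrank 𝔽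
          (π.fixedPoints (congruenceGL 2 (ValuativeRel.valuation F ((p : F) ^ n)))) : ℝ) ≤
        C * (p : ℝ) ^ (n * f)

end Literature.NumberTheory.Automorphic
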